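import Mathlib
import HarnessLib
import Literature.MathematicalPhysics.StatisticalMechanics.PolymerReblockingMap

/-!
# Block centres, the thickened diameter of connected sets, and `X* ⊆ π(X)*` ([ABKM19] (6.27)–(6.28))

For the reblocking map `π : 𝓟_k → 𝓟_{k+1}` (`TorusPolymer.reblock`) of Adams–Buchholz–Kotecký–
Müller the locality of the renormalised perturbation `K_{k+1}(U, ·)` on the small-set
neighbourhood `U*` (Lemma 6.4 (2)) rests on the inclusion (6.28), `X* ⊆ π(X)*`, which in turn
rests on (6.27): a small connected `k`-polymer lies within `(2^d − 1)L^k` of each of its blocks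
(block-aligned diameter), so that `X* = X + [−r_k, r_k]^d ⊆ B' + [−r_{k+1}, r_{k+1}]^d` for the
`(k+1)`-block `B' = π(X)` once `r_k + (2^d − 1)L^k ≤ r_{k+1}` — with the radii of (6.25)
(`r_0 = R`, `r_1 = 2^d + R`, `r_k = 2^d L^{k−1}`) this is `L ≥ 2^d + R`.

* block centres: `blockCenter_eq_of_sameBlock`, `isLatticeVec_blockCenter`,
  `supNorm_sub_blockCenter_le` (`|x − c(B_x)|_∞ ≤ (s−1)/2`), `mem_blockOf_of_supNorm_sub_le`
  (the cube of radius `(s−1)/2` about the centre is the block), `translate_blockOf_of_adjInf`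
  (adjacent points have blocks that are lattice translates at distance `≤ s`);
* **`subset_thicken_blockOf_of_isConn`** — a connected set meeting `m` blocks lies in
  `B + [−(m−1)s, (m−1)s]^d` for each of its blocks `B` ([ABKM19] (6.27): a small polymer lies in
  the cube of side `(2^{d+1} − 1)L^k` about any of its blocks);
* **`thicken_subset_thicken_reblock`** — (6.28) with generic radii: for a `k`-polymer `X`
  (`s = L^k`, `s' = L s`) and radii with `r ≤ r'`, `r + (2^d − 1)s ≤ r'`:
  `X + [−r,r]^d ⊆ π(X) + [−r',r']^d`.

Everything is proved; no named fact.

## References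
* S. Adams, S. Buchholz, R. Kotecký, S. Müller, arXiv:1910.13564, Ch. 6.2 (6.25), (6.27), Ch. 6.3
  (6.28) [AdamsBuchholzKoteckyMuller2019].
-/

noncomputable section

namespace Literature.MathematicalPhysics.StatisticalMechanics.TorusPolymer

open scoped BigOperators Classical
open Finset
open Literature.MathematicalPhysics.StatisticalMechanics.GradientFRD
  (natAbs_valMinAbs_le_supNorm supNorm_add_le supNorm_neg supNorm_eq_zero_iff)
open Literature.Barriers.CriticalPhenomena.LongRangePhi4.Polymer
  (AdjInf ConnIn IsConn comp components mem_comp comp_subset mem_comp_self isConn_comp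
    eq_biUnion_components)

variable {d M : ℕ} [NeZero M]

/-! ## Block centres -/

omit [NeZero M] in
/-- Points of one block have the same centre. [cite: AdamsKoteckyMuller2016, Ch. 4] -/
theorem blockCenter_eq_of_sameBlock {s : ℕ} {x y : Fin d → ZMod M} (h : SameBlock s x y) :
    blockCenter s x = blockCenter s y := by
  funext i; simp only [blockCenter, h i]

omit [NeZero M] in
/-- Block centres lie on the block lattice `(sℤ)^d`. [cite: AdamsKoteckyMuller2016, Ch. 4] -/
theorem isLatticeVec_blockCenter (s : ℕ) (x : Fin d → ZMod M) : IsLatticeVec s (blockCenter s x) :=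
  fun i => ⟨cubeIndex s x i, by simp only [blockCenter]; push_cast; ring⟩

omit [NeZero M] in
/-- Differences of block centres are lattice vectors. [cite: AdamsKoteckyMuller2016, Ch. 4] -/
theorem isLatticeVec_blockCenter_sub (s : ℕ) (x y : Fin d → ZMod M) :
    IsLatticeVec s (blockCenter s x - blockCenter s y) := by
  rw [sub_eq_add_neg]
  exact (isLatticeVec_blockCenter s x).add (isLatticeVec_blockCenter s y).neg

/-- The coordinate of a point relative to its block centre is its offset in `[−h, h]`
(`s = 2h + 1`, odd torus `M = s·t`). [cite: AdamsKoteckyMuller2016, Ch. 4] -/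
theorem valMinAbs_sub_blockCenter {s t : ℕ} (hMst : M = s * t) (hs : Odd s) (ht : Odd t)
    (x : Fin d → ZMod M) (i : Fin d) :
    ((x - blockCenter s x) i).valMinAbs = (x i).valMinAbs - s * cubeIndex s x i := by
  have hMo : Odd M := by rw [hMst]; exact hs.mul ht
  have hb := (resIndex_eq_iff hs (x i) (resIndex s (x i))).1 rfl
  rw [← cubeIndex_eq_resIndex] at hb
  have hh : (((s : ℤ)) - 1) / 2 = (((s - 1) / 2 : ℕ) : ℤ) := by
    obtain ⟨h, rfl⟩ := hs; push_cast; omega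
  have e : (x - blockCenter s x) i = (((x i).valMinAbs - s * cubeIndex s x i : ℤ) : ZMod M) := by
    simp only [Pi.sub_apply, blockCenter, Int.cast_sub, Int.cast_mul, Int.cast_natCast,
      ZMod.coe_valMinAbs]
    ring
  rw [e]
  apply valMinAbs_intCast_of_abs_le
  have hsM : (((s : ℤ)) - 1) / 2 ≤ (((M : ℤ)) - 1) / 2 := by
    have : s ≤ M := by
      rw [hMst]; obtain ⟨m, rfl⟩ := ht; nlinarith
    omega
  rw [abs_le]
  constructor <;> linarith [hb.1, hb.2]

/-- **`|x − c(B_x)|_∞ ≤ (s−1)/2`**: every point is within half a side of its block centre.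
[cite: AdamsKoteckyMuller2016, Ch. 4] -/
theorem supNorm_sub_blockCenter_le {s t : ℕ} (hMst : M = s * t) (hs : Odd s) (ht : Odd t)
    (x : Fin d → ZMod M) : GradientFRD.supNorm (x - blockCenter s x) ≤ (s - 1) / 2 := by
  rw [supNorm_le_iff]
  intro i
  rw [valMinAbs_sub_blockCenter hMst hs ht x i]
  have hb := (resIndex_eq_iff hs (x i) (resIndex s (x i))).1 rfl
  rw [← cubeIndex_eq_resIndex] at hb
  have hh : (((s : ℤ)) - 1) / 2 = (((s - 1) / 2 : ℕ) : ℤ) := by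
    obtain ⟨h, rfl⟩ := hs; push_cast; omega
  rw [hh] at hb
  omega

/-- **The cube of radius `(s−1)/2` about a block centre is the block**: `|z − c(B_x)|_∞ ≤ (s−1)/2`
implies `z ∈ B_x` (odd torus `M = s·t`). [cite: AdamsKoteckyMuller2016, Ch. 4] -/
theorem mem_blockOf_of_supNorm_sub_le {s t : ℕ} (hMst : M = s * t) (hs : Odd s) (ht : Odd t)
    {x z : Fin d → ZMod M} (hz : GradientFRD.supNorm (z - blockCenter s x) ≤ (s - 1) / 2) :
    z ∈ blockOf s x := by
  haveI : NeZero t := ⟨by rintro rfl; simp at hMst; exact NeZero.ne M hMst⟩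
  rw [mem_blockOf]
  intro i
  rw [supNorm_le_iff] at hz
  have hzi := hz i
  -- `z_i = δ + s·b` with `|δ| ≤ h`, `b = cubeIndex s x i`
  set δ : ℤ := ((z - blockCenter s x) i).valMinAbs with hδ
  have hzeq : z i = ((δ : ℤ) : ZMod M) + ((s * cubeIndex s x i : ℤ) : ZMod M) := by
    have : ((δ : ℤ) : ZMod M) = z i - blockCenter s x i := by
      rw [hδ, ZMod.coe_valMinAbs]; rfl
    rw [this]; simp only [blockCenter]; push_cast; ring
  have hh : (((s : ℤ)) - 1) / 2 = (((s - 1) / 2 : ℕ) : ℤ) := by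
    obtain ⟨h, rfl⟩ := hs; push_cast; omega
  have hδabs : |δ| ≤ (((s - 1) / 2 : ℕ) : ℤ) := by
    have : (δ.natAbs : ℤ) ≤ (((s - 1) / 2 : ℕ) : ℤ) := by exact_mod_cast hzi
    rwa [Int.natCast_natAbs] at this
  -- the residue `δ` has block index `0`
  have hδM : |δ| ≤ (((M : ℤ)) - 1) / 2 := by
    have : s ≤ M := by rw [hMst]; obtain ⟨m, rfl⟩ := ht; nlinarith
    rw [abs_le] at hδabs ⊢; constructor <;> omega
  have hres0 : resIndex s ((δ : ℤ) : ZMod M) = 0 := by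
    rw [resIndex_eq_iff hs, valMinAbs_intCast_of_abs_le hδM, hh]
    rw [abs_le] at hδabs
    constructor <;> linarith
  -- `cubeIndex s x i` lies in the symmetric range of `ZMod t`
  have hrange := abs_resIndex_le hMst hs ht (x i)
  symm
  rw [cubeIndex_eq_resIndex s z i, hzeq, resIndex_add_latticeVec hMst hs ht, hres0, zero_add,
    cubeIndex_eq_resIndex]
  exact valMinAbs_intCast_of_abs_le hrange

/-- **Adjacent points have blocks that are lattice translates at distance `≤ s`**: if `AdjInf a c`
then `v = c(B_a) − c(B_c) ∈ (sℤ)^d`, `|v|_∞ ≤ s`, and `B_c + v = B_a`.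
[cite: AdamsBuchholzKoteckyMuller2019, Ch. 6.2 (6.27)] -/
theorem translate_blockOf_of_adjInf {s t : ℕ} (hMst : M = s * t) (hs : Odd s) (ht : Odd t)
    {a c : Fin d → ZMod M} (hac : AdjInf a c) :
    GradientFRD.supNorm (blockCenter s a - blockCenter s c) ≤ s ∧
      translate (blockCenter s a - blockCenter s c) (blockOf s c) = blockOf s a := by
  have hlat : IsLatticeVec s (blockCenter s a - blockCenter s c) := isLatticeVec_blockCenter_sub s a c
  have hh2 : (s - 1) / 2 + 1 + (s - 1) / 2 = s := by obtain ⟨h, rfl⟩ := hs; omega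
  constructor
  · -- `|c(B_a) − c(B_c)| ≤ |c(B_a) − a| + |a − c| + |c − c(B_c)| ≤ h + 1 + h = s`
    have h1 := supNorm_sub_blockCenter_le hMst hs ht a
    have h2 := supNorm_sub_le_one_of_adjInf hac
    have h3 := supNorm_sub_blockCenter_le hMst hs ht c
    have t1 := supNorm_sub_le (blockCenter s a) a (blockCenter s c)
    have t2 := supNorm_sub_le a c (blockCenter s c)
    rw [supNorm_sub_comm (blockCenter s a) a] at t1
    omega
  · -- `B_c + v = B_{c + v}` and `c + v` lies within `h` of `c(B_a)`
    rw [← blockOf_add hMst hs ht hlat c]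
    apply blockOf_eq_of_mem
    apply mem_blockOf_of_supNorm_sub_le hMst hs ht
    have : c + (blockCenter s a - blockCenter s c) - blockCenter s a = c - blockCenter s c := by abel
    rw [this]
    exact supNorm_sub_blockCenter_le hMst hs ht c

/-! ## The block-aligned diameter of a connected set ([ABKM19] (6.27)) -/

/-- Frontier crossing along a path. [folklore] -/
private theorem exists_step_of_reflTransGen'' {α : Type*} {R : α → α → Prop} {S : Set α} {x y : α}
    (h : Relation.ReflTransGen R x y) (hx : x ∉ S) (hy : y ∈ S) :
    ∃ a c, Relation.ReflTransGen R x a ∧ R a c ∧ a ∉ S ∧ c ∈ S ∧ Relation.ReflTransGen R c y := by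
  induction h with
  | refl => exact absurd hy hx
  | @tail b z hxb hbz ih =>
    by_cases hb : b ∈ S
    · obtain ⟨a, c, h1, h2, h3, h4, h5⟩ := ih hb
      exact ⟨a, c, h1, h2, h3, h4, h5.tail hbz⟩
    · exact ⟨b, z, hxb, hbz, hb, hy, Relation.ReflTransGen.refl⟩

/-- **Block-aligned diameter**: if `y` is joined to `x` inside `X` (odd torus `M = s·t`), then
`y ∈ B_x + [−(n−1)s, (n−1)s]^d` where `n = |𝓑_k(X)|` — leave `B_x` for the last time through an
adjacent pair `a ∈ B_x`, `c ∉ B_x`, translate the induction hypothesis for `X ∖ B_x` from `B_c` to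
`B_a = B_x` by the lattice vector `c(B_a) − c(B_c)` of length `≤ s`.
[cite: AdamsBuchholzKoteckyMuller2019, Ch. 6.2 (6.27)] -/
theorem mem_thicken_blockOf_of_connIn {s t : ℕ} (hMst : M = s * t) (hs : Odd s) (ht : Odd t)
    {X : Finset (Fin d → ZMod M)} {x y : Fin d → ZMod M} (hx : x ∈ X) (h : ConnIn X x y) :
    y ∈ thicken (((blocks s X).card - 1) * s) (blockOf s x) := by
  suffices H : ∀ (n : ℕ) (X : Finset (Fin d → ZMod M)) (x y : Fin d → ZMod M), (blocks s X).card = n →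
      x ∈ X → ConnIn X x y → y ∈ thicken ((n - 1) * s) (blockOf s x) from H _ X x y rfl hx h
  intro n
  induction n using Nat.strong_induction_on with
  | _ n ih =>
    intro X x y hn hx h
    have hBmem : blockOf s x ∈ blocks s X := mem_blocks.2 ⟨x, hx, rfl⟩
    by_cases hyB : y ∈ blockOf s x
    · exact thicken_mono_rad (Nat.zero_le _) _ (by rw [thicken_zero]; exact hyB)
    · set S : Set (Fin d → ZMod M) := {z | z ∈ X \ blockOf s x ∧ ConnIn (X \ blockOf s x) z y}
      have hyX : y ∈ X := by
        by_cases hxy : x = y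
        · subst hxy; exact hx
        · exact h.mem_of_ne hxy
      have hyS : y ∈ S := ⟨mem_sdiff.2 ⟨hyX, hyB⟩, Relation.ReflTransGen.refl⟩
      have hxS : x ∉ S := fun h' => (mem_sdiff.1 h'.1).2 (mem_blockOf_self s x)
      obtain ⟨a, c, -, hac, haS, hcS, -⟩ := exists_step_of_reflTransGen'' h hxS hyS
      have haB : a ∈ blockOf s x := by
        by_contra haB
        exact haS ⟨mem_sdiff.2 ⟨hac.1, haB⟩,
          Relation.ReflTransGen.head ⟨mem_sdiff.2 ⟨hac.1, haB⟩, hcS.1, hac.2.2⟩ hcS.2⟩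
      have hcard : (blocks s (X \ blockOf s x)).card = n - 1 := by
        rw [blocks_sdiff_blockOf, card_erase_of_mem hBmem, hn]
      have hn1 : 1 ≤ n := by rw [← hn]; exact card_pos.2 ⟨_, hBmem⟩
      have hn2 : 2 ≤ n := by
        have : 1 ≤ (blocks s (X \ blockOf s x)).card :=
          card_pos.2 ⟨blockOf s c, mem_blocks.2 ⟨c, hcS.1, rfl⟩⟩
        omega
      have hIH := ih (n - 1) (by omega) (X \ blockOf s x) c y hcard hcS.1 hcS.2
      -- translate from `B_c` to `B_a = B_x`
      obtain ⟨c', hc', hyc'⟩ := mem_thicken.1 hIH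
      obtain ⟨hvs, hBv⟩ := translate_blockOf_of_adjInf hMst hs ht hac.2.2
      have hBa : blockOf s a = blockOf s x := blockOf_eq_of_mem haB
      set v := blockCenter s a - blockCenter s c
      refine mem_thicken.2 ⟨c' + v, ?_, ?_⟩
      · rw [← hBa, ← hBv]; exact add_mem_translate_iff.2 hc'
      · have t1 := supNorm_sub_le y c' (c' + v)
        have e : GradientFRD.supNorm (c' - (c' + v)) = GradientFRD.supNorm v := by
          rw [sub_add_cancel_left, GradientFRD.supNorm_neg]
        rw [e] at t1
        have : (n - 1 - 1) * s + s = (n - 1) * s := by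
          rw [← Nat.succ_mul]; congr 1; omega
        calc GradientFRD.supNorm (y - (c' + v)) ≤ (n - 1 - 1) * s + s := by omega
          _ = (n - 1) * s := this

/-- **(6.27)**: a connected set meeting at most `m` blocks lies in `B + [−(m−1)s, (m−1)s]^d` for the
block `B` of any of its points (odd torus `M = s·t`).
[cite: AdamsBuchholzKoteckyMuller2019, Ch. 6.2 (6.27)] -/
theorem subset_thicken_blockOf_of_isConn {s t m : ℕ} (hMst : M = s * t) (hs : Odd s) (ht : Odd t)
    {X : Finset (Fin d → ZMod M)} (hX : IsConn X) (hm : (blocks s X).card ≤ m)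
    {x : Fin d → ZMod M} (hx : x ∈ X) : X ⊆ thicken ((m - 1) * s) (blockOf s x) := fun _ hy =>
  thicken_mono_rad (Nat.mul_le_mul_right s (Nat.sub_le_sub_right hm 1)) _
    (mem_thicken_blockOf_of_connIn hMst hs ht hx (hX.2 x hx _ hy))

/-! ## (6.28): `X* ⊆ π(X)*` -/

/-- **(6.28) for a connected polymer**: with `s' = L·s` (`L` odd), radii `r ≤ r'` and
`r + (2^d − 1)s ≤ r'`: `X + [−r,r]^d ⊆ π(X) + [−r',r']^d`.
[cite: AdamsBuchholzKoteckyMuller2019, Ch. 6.3 (6.28)] -/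
theorem thicken_subset_thicken_reblock_of_isConn {s t L r r' : ℕ} (hMst : M = s * t) (hs : Odd s)
    (ht : Odd t) (hL : Odd L) (hrr : r ≤ r') (hr : r + (2 ^ d - 1) * s ≤ r')
    {X : Finset (Fin d → ZMod M)} (hX : IsConn X) :
    thicken r X ⊆ thicken r' (reblock s (L * s) X) := by
  by_cases hsmall : (blocks s X).card ≤ 2 ^ d
  · obtain ⟨x, hx, hπ⟩ := reblock_of_isConn_of_card_le s (L * s) hX hsmall
    rw [hπ]
    have h1 : X ⊆ thicken ((2 ^ d - 1) * s) (blockOf (L * s) x) :=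
      (subset_thicken_blockOf_of_isConn hMst hs ht hX hsmall hx).trans
        (thicken_mono _ (blockOf_subset_blockOf_mul hs hL x))
    exact (thicken_mono r h1).trans ((thicken_thicken _ _ _).trans (thicken_mono_rad (by omega) _))
  · rw [reblock_of_isConn_of_lt_card s (L * s) hX (not_le.1 hsmall)]
    exact (thicken_mono r (subset_closure (L * s) X)).trans (thicken_mono_rad hrr _)

/-- **(6.28)**: for every `k`-polymer `X` (`s = L^k`, `s' = L s`, odd torus `M = s·t`, `L` odd) and
radii with `r ≤ r'`, `r + (2^d − 1)s ≤ r'`: `X + [−r,r]^d ⊆ π(X) + [−r',r']^d`.  With the radii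
of (6.25) (`r_0 = R`, `r_1 = 2^d + R`, `r_k = 2^d L^{k−1}`) the hypotheses hold for `L ≥ 2^d + R`,
and the statement is `X* ⊆ π(X)*`. [cite: AdamsBuchholzKoteckyMuller2019, Ch. 6.3 (6.28)] -/
theorem thicken_subset_thicken_reblock {s t L r r' : ℕ} (hMst : M = s * t) (hs : Odd s)
    (ht : Odd t) (hL : Odd L) (hrr : r ≤ r') (hr : r + (2 ^ d - 1) * s ≤ r')
    (X : Finset (Fin d → ZMod M)) :
    thicken r X ⊆ thicken r' (reblock s (L * s) X) := by
  intro y hy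
  obtain ⟨x, hx, hyx⟩ := mem_thicken.1 hy
  have hY : comp X x ∈ components X := mem_image.2 ⟨x, hx, rfl⟩
  have h1 : y ∈ thicken r (comp X x) := mem_thicken.2 ⟨x, mem_comp_self hx, hyx⟩
  have h2 := thicken_subset_thicken_reblock_of_isConn hMst hs ht hL hrr hr (isConn_comp hx) h1
  refine thicken_mono r' ?_ h2
  rw [reblock_eq_biUnion_components s (L * s) X]
  exact subset_biUnion_of_mem (reblock s (L * s)) hY

end Literature.MathematicalPhysics.StatisticalMechanics.TorusPolymer

end
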